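import Mathlib
import Literature.Combinatorics.Enumerative.FpfInvolutionsAvoiding3412And123
import HarnessLib

/-!
# Centrosymmetric involutions avoiding `3412` and `123`: `|CI_{2h}(3412,123)| = h + 1`, `|CI_{2h+1}(3412,123)| = 1` (Barnabei–Bonetti–Silimbani 2011, Theorem 14 (vii))

Layer `Literature/Combinatorics/Enumerative`, namespace `Literature.Combinatorics.Enumerative.PermContainsPattern`; lane
`lit-hodgefound` (prover seat p13, generation 39, theme «nonnesting / noncrossing matchings and restricted
involutions»).  Sequel of `InvolutionsAvoiding3412And123.lean` (THEOREM 8 (iv): a `3412`- and `123`-avoiding involution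
is connected, `β_ρ` with `ρ ∈ I_{n−2}(3412,123)`, or the two reversal blocks `twoRev n j` = `j+1 ⋯ 1 n ⋯ j+2`) and
`FpfInvolutionsAvoiding3412And123.lean`.

## Source

M. Barnabei, F. Bonetti, M. Silimbani, *Restricted involutions and Motzkin paths*, Adv. Appl. Math. **47** (2011)
102–115 = arXiv:0812.0463 [BarnabeiBonettiSilimbani2011] (held text `paper-arxiv-0812.0463`, arXiv numbering, §7):

> A centrosymmetric involution is an element `τ ∈ I_n` such that `τ_{rc} = τ`, namely, an involution such that
> `τ(i) + τ(n+1−i) = n + 1`, for every `1 ≤ i ≤ n`. Denote by `CI_n` the set of centrosymmetric involutions in `I_n`.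
> … **Theorem 14.** We have: … vii. `|CI_{2h}(3412,123)| = h + 1`, `|CI_{2h+1}(3412,123)| = 1`.

(The source derives (vii) «from the analogous theorems for the set of all involutions»; we follow Theorem 8 (iv).)

## Formalisation (arc language; theorems only)

Centrosymmetry of `u : Perm (Fin n)` is the condition `∀ i, u (rev i) = rev (u i)`.
* §1 `rev_castAdd_succ` (`rev` on the middle letters), `arcBlock_centrosymmetric_iff` (`β_ρ` is centrosymmetric iff
  `ρ` is), `twoRev_centrosymmetric_iff` (`twoRev n j`, `j + 1 < n`, is centrosymmetric iff its two blocks have the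
  same size, `2j + 2 = n`).
* §2 Sorting `CI_{b+2}(3412,123)` by the first letter: `card_centrosymmetric_av3412_av123_connected` (`↔ CI_b`),
  `card_centrosymmetric_av3412_av123_first` (one for `2j = b`, none otherwise), ★★ `card_centrosymmetric_av3412_av123_add_two`
  (`c_{b+2} = c_b + [b even]`).
* §3 ★★★ THEOREM 14 (vii): `card_centrosymmetric_av3412_av123_two_mul` (`= h + 1`),
  `card_centrosymmetric_av3412_av123_odd` (`= 1`), values.
-/

namespace Literature.Combinatorics.Enumerative

namespace PermContainsPattern

open Finset Equiv

variable {n b : ℕ}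

/-! ### §1 Centrosymmetry of `β_ρ` and of `twoRev` -/

/-- `rev` of a middle letter `x + 1` of `[0, b+1]` is the middle letter `rev x + 1`. [folklore] -/
private theorem rev_castAdd_succ (x : Fin b) :
    Fin.rev (Fin.castAdd 1 x.succ : Fin (b + 1 + 1)) = Fin.castAdd 1 (Fin.rev x).succ := by
  apply Fin.ext
  simp only [Fin.val_rev, Fin.val_castAdd, Fin.val_succ]
  omega

/-- `β_ρ` (the arc `(0, last)` around `ρ` shifted by one) is centrosymmetric iff `ρ` is.
[cite: BarnabeiBonettiSilimbani2011, §7 and Theorem 14 (vii) (arXiv 0812.0463)] -/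
theorem arcBlock_centrosymmetric_iff (ρ : Perm (Fin b)) :
    (∀ y : Fin (b + 1 + 1), (swap (0 : Fin (b + 1 + 1)) (Fin.last (b + 1)) * finSumFinEquiv.symm.trans
        (((Perm.decomposeFin.symm (0, ρ) : Perm (Fin (b + 1))).sumCongr (1 : Perm (Fin 1))).trans finSumFinEquiv))
          (Fin.rev y) =
      Fin.rev ((swap (0 : Fin (b + 1 + 1)) (Fin.last (b + 1)) * finSumFinEquiv.symm.trans
        (((Perm.decomposeFin.symm (0, ρ) : Perm (Fin (b + 1))).sumCongr (1 : Perm (Fin 1))).trans finSumFinEquiv)) y)) ↔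
      ∀ x : Fin b, ρ (Fin.rev x) = Fin.rev (ρ x) := by
  constructor
  · intro h x
    have hx := h (Fin.castAdd 1 x.succ)
    rw [rev_castAdd_succ, arcBlock_apply_mid, arcBlock_apply_mid, rev_castAdd_succ] at hx
    exact Fin.succ_injective _ (Fin.castAdd_injective _ _ hx)
  · intro h y
    by_cases h0 : y = 0
    · subst h0
      rw [Fin.rev_zero, arcBlock_apply_last, arcBlock_apply_zero, Fin.rev_last]
    by_cases hl : y = Fin.last (b + 1)
    · subst hl
      rw [Fin.rev_last, arcBlock_apply_zero, arcBlock_apply_last, Fin.rev_zero]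
    · obtain ⟨x, rfl⟩ : ∃ x : Fin b, y = Fin.castAdd 1 x.succ := by
        have h1 : (y : ℕ) ≠ 0 := fun e => h0 (Fin.ext (by rw [e]; simp))
        have h2 : (y : ℕ) ≠ b + 1 := fun e => hl (Fin.ext (by rw [e, Fin.val_last]))
        refine ⟨⟨(y : ℕ) - 1, by have := y.2; omega⟩, Fin.ext ?_⟩
        simp; omega
      rw [rev_castAdd_succ, arcBlock_apply_mid, arcBlock_apply_mid, rev_castAdd_succ, h]

/-- `twoRev n j` with `j + 1 < n` (two genuine blocks) is centrosymmetric iff the blocks have the same size: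
`2j + 2 = n`. [cite: BarnabeiBonettiSilimbani2011, §7 and Theorem 14 (vii) (arXiv 0812.0463)] -/
theorem twoRev_centrosymmetric_iff (n j : ℕ) (hj : j < n) (hjl : j + 1 < n) :
    (∀ y : Fin n, twoRev n j hj (Fin.rev y) = Fin.rev (twoRev n j hj y)) ↔ 2 * j + 2 = n := by
  constructor
  · intro h
    have := congrArg Fin.val (h ⟨0, by omega⟩)
    rw [twoRev_val, Fin.val_rev, Fin.val_rev, twoRev_val] at this
    dsimp only at this
    split_ifs at this <;> omega
  · intro hn y
    apply Fin.ext
    rw [twoRev_val, Fin.val_rev, Fin.val_rev, twoRev_val]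
    have hy := y.2
    split_ifs <;> omega

/-! ### §2 Sorting `CI_{b+2}(3412, 123)` by the first letter -/

/-- ★ The connected centrosymmetric involutions of `CI_{b+2}(3412,123)` (first letter `last`) are the `β_ρ`,
`ρ ∈ CI_b(3412,123)`. [cite: BarnabeiBonettiSilimbani2011, Theorem 14 (vii) with Theorem 8 (iv) (arXiv 0812.0463)] -/
theorem card_centrosymmetric_av3412_av123_connected (b : ℕ) :
    Nat.card {u : Perm (Fin (b + 1 + 1)) // ((u * u = 1 ∧ ¬ PermContainsPattern u ![3, 4, 1, 2] ∧
        ¬ PermContainsPattern u ![1, 2, 3]) ∧ ∀ i, u (Fin.rev i) = Fin.rev (u i)) ∧ u 0 = Fin.last (b + 1)} =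
      Nat.card {ρ : Perm (Fin b) // (ρ * ρ = 1 ∧ ¬ PermContainsPattern ρ ![3, 4, 1, 2] ∧
        ¬ PermContainsPattern ρ ![1, 2, 3]) ∧ ∀ i, ρ (Fin.rev i) = Fin.rev (ρ i)} := by
  refine (Nat.card_congr (Equiv.ofBijective (fun ρ : {ρ : Perm (Fin b) // (ρ * ρ = 1 ∧
      ¬ PermContainsPattern ρ ![3, 4, 1, 2] ∧ ¬ PermContainsPattern ρ ![1, 2, 3]) ∧ ∀ i, ρ (Fin.rev i) = Fin.rev (ρ i)} =>
    (⟨swap (0 : Fin (b + 1 + 1)) (Fin.last (b + 1)) * finSumFinEquiv.symm.trans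
        (((Perm.decomposeFin.symm (0, ρ.1) : Perm (Fin (b + 1))).sumCongr (1 : Perm (Fin 1))).trans finSumFinEquiv),
      ⟨⟨(arcBlock_mul_self_eq_one_iff ρ.1).2 ρ.2.1.1,
        (arcBlock_not_contains_3412_iff ((mul_self_eq_one_iff_apply_apply _).1 ρ.2.1.1)).2 ρ.2.1.2.1,
        (arcBlock_not_contains_123_iff ρ.1).2 ρ.2.1.2.2⟩, (arcBlock_centrosymmetric_iff ρ.1).2 ρ.2.2⟩,
      arcBlock_apply_zero ρ.1⟩ :
    {u : Perm (Fin (b + 1 + 1)) // ((u * u = 1 ∧ ¬ PermContainsPattern u ![3, 4, 1, 2] ∧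
      ¬ PermContainsPattern u ![1, 2, 3]) ∧ ∀ i, u (Fin.rev i) = Fin.rev (u i)) ∧ u 0 = Fin.last (b + 1)})) ⟨?_, ?_⟩)).symm
  · rintro ⟨ρ, hρ⟩ ⟨ρ', hρ'⟩ h
    exact Subtype.ext (arcBlock_injective b (congrArg Subtype.val h))
  · rintro ⟨u, ⟨⟨hinv, h3412, h123⟩, hcs⟩, h0⟩
    have hu : ∀ x, u (u x) = x := (mul_self_eq_one_iff_apply_apply u).1 hinv
    obtain ⟨ρ, rfl⟩ := exists_eq_arcBlock u hu h0
    have hρinv : ρ * ρ = 1 := (arcBlock_mul_self_eq_one_iff ρ).1 hinv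
    have hρu : ∀ x, ρ (ρ x) = x := (mul_self_eq_one_iff_apply_apply ρ).1 hρinv
    exact ⟨⟨ρ, ⟨hρinv, (arcBlock_not_contains_3412_iff hρu).1 h3412, (arcBlock_not_contains_123_iff ρ).1 h123⟩,
      (arcBlock_centrosymmetric_iff ρ).1 hcs⟩, rfl⟩

/-- ★ The fibre over a first letter `j < last`: the single candidate `twoRev (b+2) j` is centrosymmetric iff `2j = b`.
[cite: BarnabeiBonettiSilimbani2011, Theorem 14 (vii) with Theorem 8 (iv) (arXiv 0812.0463)] -/
theorem card_centrosymmetric_av3412_av123_first (b : ℕ) (j : Fin (b + 1 + 1)) (hj : j ≠ Fin.last (b + 1)) :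
    Nat.card {u : Perm (Fin (b + 1 + 1)) // ((u * u = 1 ∧ ¬ PermContainsPattern u ![3, 4, 1, 2] ∧
        ¬ PermContainsPattern u ![1, 2, 3]) ∧ ∀ i, u (Fin.rev i) = Fin.rev (u i)) ∧ u 0 = j} =
      if 2 * (j : ℕ) = b then 1 else 0 := by
  have hjl : (j : ℕ) < b + 1 := lt_of_le_of_ne (Nat.lt_succ_iff.1 j.2) fun e => hj (Fin.ext (by rw [e, Fin.val_last]))
  have huniq : ∀ u : Perm (Fin (b + 1 + 1)), ((u * u = 1 ∧ ¬ PermContainsPattern u ![3, 4, 1, 2] ∧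
      ¬ PermContainsPattern u ![1, 2, 3]) ∧ ∀ i, u (Fin.rev i) = Fin.rev (u i)) ∧ u 0 = j → u = twoRev (b + 1 + 1) j j.2 :=
    fun u ⟨⟨⟨hinv, h3412, h123⟩, _⟩, h0⟩ =>
      eq_twoRev ((mul_self_eq_one_iff_apply_apply u).1 hinv) h3412 h123 (congrArg Fin.val h0) hjl
  split_ifs with hc
  · have : Unique {u : Perm (Fin (b + 1 + 1)) // ((u * u = 1 ∧ ¬ PermContainsPattern u ![3, 4, 1, 2] ∧
        ¬ PermContainsPattern u ![1, 2, 3]) ∧ ∀ i, u (Fin.rev i) = Fin.rev (u i)) ∧ u 0 = j} :=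
      { default := ⟨twoRev (b + 1 + 1) j j.2, ⟨twoRev_mem _ _ _,
          (twoRev_centrosymmetric_iff _ _ j.2 (by omega)).2 (by omega)⟩, Fin.ext (by rw [twoRev_val]; simp)⟩
        uniq := fun u => Subtype.ext (huniq u.1 u.2) }
    exact Nat.card_unique
  · rw [Nat.card_eq_zero]
    left
    refine ⟨fun u => ?_⟩
    have e := huniq u.1 u.2
    have hcs := u.2.1.2
    rw [e] at hcs
    have := (twoRev_centrosymmetric_iff _ _ j.2 (by omega)).1 hcs
    exact hc (by omega)

/-- Splitting a finite subtype along a statistic with values in a `Fintype`. [folklore] -/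
private theorem card_subtype_eq_sum_fiber₈ {α β : Type*} [Finite α] [Fintype β] (P : α → Prop) (f : α → β) :
    Nat.card {x // P x} = ∑ t : β, Nat.card {x // P x ∧ f x = t} := by
  rw [← Nat.card_sigma]
  exact Nat.card_congr ((Equiv.sigmaFiberEquiv fun x : {x // P x} => f x.1).symm.trans
    (Equiv.sigmaCongrRight fun t => Equiv.subtypeSubtypeEquivSubtypeInter P fun x => f x = t))

/-- `Σ_{j ≤ b} [2j = b] = [b even]`. [folklore] -/
private theorem sum_fin_ite_two_mul_eq (b : ℕ) :
    ∑ j : Fin (b + 1), (if 2 * (j : ℕ) = b then 1 else 0) = if b % 2 = 0 then 1 else 0 := by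
  rw [Fin.sum_univ_eq_sum_range (fun j => if 2 * j = b then 1 else 0) (b + 1)]
  split_ifs with hb
  · rw [Finset.sum_eq_single (b / 2) (fun j _ hj => if_neg (by omega)) (fun h => absurd (mem_range.2 (by omega)) h),
      if_pos (by omega)]
  · exact Finset.sum_eq_zero fun j _ => if_neg (by omega)

/-- ★★ **The recurrence** `c_{b+2} = c_b + [b even]`: a connected centrosymmetric involution `β_ρ`, or — for even `b` —
the two equal reversal blocks. [cite: BarnabeiBonettiSilimbani2011, Theorem 14 (vii) (arXiv 0812.0463)] -/
theorem card_centrosymmetric_av3412_av123_add_two (b : ℕ) :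
    Nat.card {u : Perm (Fin (b + 2)) // (u * u = 1 ∧ ¬ PermContainsPattern u ![3, 4, 1, 2] ∧
        ¬ PermContainsPattern u ![1, 2, 3]) ∧ ∀ i, u (Fin.rev i) = Fin.rev (u i)} =
      Nat.card {u : Perm (Fin b) // (u * u = 1 ∧ ¬ PermContainsPattern u ![3, 4, 1, 2] ∧
          ¬ PermContainsPattern u ![1, 2, 3]) ∧ ∀ i, u (Fin.rev i) = Fin.rev (u i)} + if b % 2 = 0 then 1 else 0 := by
  rw [card_subtype_eq_sum_fiber₈ (fun u : Perm (Fin (b + 2)) => (u * u = 1 ∧ ¬ PermContainsPattern u ![3, 4, 1, 2] ∧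
      ¬ PermContainsPattern u ![1, 2, 3]) ∧ ∀ i, u (Fin.rev i) = Fin.rev (u i)) (fun u => u 0), Fin.sum_univ_castSucc,
    Finset.sum_congr rfl fun j _ => card_centrosymmetric_av3412_av123_first b _ (ne_of_lt (Fin.castSucc_lt_last j)),
    card_centrosymmetric_av3412_av123_connected, add_comm]
  congr 1
  simp only [Fin.val_castSucc]
  exact sum_fin_ite_two_mul_eq b

/-! ### §3 THEOREM 14 (vii) -/

/-- `c_0 = 1`. [cite: BarnabeiBonettiSilimbani2011, Theorem 14 (vii) (arXiv 0812.0463)] -/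
theorem card_centrosymmetric_av3412_av123_zero :
    Nat.card {u : Perm (Fin 0) // (u * u = 1 ∧ ¬ PermContainsPattern u ![3, 4, 1, 2] ∧
      ¬ PermContainsPattern u ![1, 2, 3]) ∧ ∀ i, u (Fin.rev i) = Fin.rev (u i)} = 1 := by
  have : Unique {u : Perm (Fin 0) // (u * u = 1 ∧ ¬ PermContainsPattern u ![3, 4, 1, 2] ∧
      ¬ PermContainsPattern u ![1, 2, 3]) ∧ ∀ i, u (Fin.rev i) = Fin.rev (u i)} :=
    { default := ⟨1, ⟨by simp, not_contains_of_lt _ _ (by norm_num), not_contains_of_lt _ _ (by norm_num)⟩,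
        fun i => Fin.elim0 i⟩
      uniq := fun u => Subtype.ext (Equiv.ext fun x => Fin.elim0 x) }
  exact Nat.card_unique

/-- `c_1 = 1`. [cite: BarnabeiBonettiSilimbani2011, Theorem 14 (vii) (arXiv 0812.0463)] -/
theorem card_centrosymmetric_av3412_av123_one :
    Nat.card {u : Perm (Fin 1) // (u * u = 1 ∧ ¬ PermContainsPattern u ![3, 4, 1, 2] ∧
      ¬ PermContainsPattern u ![1, 2, 3]) ∧ ∀ i, u (Fin.rev i) = Fin.rev (u i)} = 1 := by
  have : Unique {u : Perm (Fin 1) // (u * u = 1 ∧ ¬ PermContainsPattern u ![3, 4, 1, 2] ∧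
      ¬ PermContainsPattern u ![1, 2, 3]) ∧ ∀ i, u (Fin.rev i) = Fin.rev (u i)} :=
    { default := ⟨1, ⟨by simp, not_contains_of_lt _ _ (by norm_num), not_contains_of_lt _ _ (by norm_num)⟩,
        fun i => rfl⟩
      uniq := fun u => Subtype.ext (Equiv.ext fun x => Subsingleton.elim _ _) }
  exact Nat.card_unique

/-- ★★★ **THEOREM 14 (vii), even length: `|CI_{2h}(3412, 123)| = h + 1`.** [cite: BarnabeiBonettiSilimbani2011, Theorem 14 (vii) (arXiv 0812.0463)] -/
theorem card_centrosymmetric_av3412_av123_two_mul (h : ℕ) :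
    Nat.card {u : Perm (Fin (2 * h)) // (u * u = 1 ∧ ¬ PermContainsPattern u ![3, 4, 1, 2] ∧
      ¬ PermContainsPattern u ![1, 2, 3]) ∧ ∀ i, u (Fin.rev i) = Fin.rev (u i)} = h + 1 := by
  induction h with
  | zero => rw [Nat.mul_zero, card_centrosymmetric_av3412_av123_zero]
  | succ h ih =>
    rw [show 2 * (h + 1) = 2 * h + 2 by ring, card_centrosymmetric_av3412_av123_add_two, ih, if_pos (by omega)]

/-- ★★★ **THEOREM 14 (vii), odd length: `|CI_{2h+1}(3412, 123)| = 1`** (the connected tower over the middle fixed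
point). [cite: BarnabeiBonettiSilimbani2011, Theorem 14 (vii) (arXiv 0812.0463)] -/
theorem card_centrosymmetric_av3412_av123_odd (h : ℕ) :
    Nat.card {u : Perm (Fin (2 * h + 1)) // (u * u = 1 ∧ ¬ PermContainsPattern u ![3, 4, 1, 2] ∧
      ¬ PermContainsPattern u ![1, 2, 3]) ∧ ∀ i, u (Fin.rev i) = Fin.rev (u i)} = 1 := by
  induction h with
  | zero => exact card_centrosymmetric_av3412_av123_one
  | succ h ih =>
    rw [show 2 * (h + 1) + 1 = (2 * h + 1) + 2 by ring, card_centrosymmetric_av3412_av123_add_two, ih, if_neg (by omega)]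

/-- Values: `|CI_n(3412, 123)| = 1, 1, 2, 1, 3, 1, 4` for `n = 0, …, 6`. [cite: BarnabeiBonettiSilimbani2011, Theorem 14 (vii) (arXiv 0812.0463)] -/
theorem card_centrosymmetric_av3412_av123_values :
    [Nat.card {u : Perm (Fin (2 * 0)) // (u * u = 1 ∧ ¬ PermContainsPattern u ![3, 4, 1, 2] ∧
        ¬ PermContainsPattern u ![1, 2, 3]) ∧ ∀ i, u (Fin.rev i) = Fin.rev (u i)},
      Nat.card {u : Perm (Fin (2 * 0 + 1)) // (u * u = 1 ∧ ¬ PermContainsPattern u ![3, 4, 1, 2] ∧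
        ¬ PermContainsPattern u ![1, 2, 3]) ∧ ∀ i, u (Fin.rev i) = Fin.rev (u i)},
      Nat.card {u : Perm (Fin (2 * 1)) // (u * u = 1 ∧ ¬ PermContainsPattern u ![3, 4, 1, 2] ∧
        ¬ PermContainsPattern u ![1, 2, 3]) ∧ ∀ i, u (Fin.rev i) = Fin.rev (u i)},
      Nat.card {u : Perm (Fin (2 * 1 + 1)) // (u * u = 1 ∧ ¬ PermContainsPattern u ![3, 4, 1, 2] ∧
        ¬ PermContainsPattern u ![1, 2, 3]) ∧ ∀ i, u (Fin.rev i) = Fin.rev (u i)},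
      Nat.card {u : Perm (Fin (2 * 2)) // (u * u = 1 ∧ ¬ PermContainsPattern u ![3, 4, 1, 2] ∧
        ¬ PermContainsPattern u ![1, 2, 3]) ∧ ∀ i, u (Fin.rev i) = Fin.rev (u i)},
      Nat.card {u : Perm (Fin (2 * 2 + 1)) // (u * u = 1 ∧ ¬ PermContainsPattern u ![3, 4, 1, 2] ∧
        ¬ PermContainsPattern u ![1, 2, 3]) ∧ ∀ i, u (Fin.rev i) = Fin.rev (u i)},
      Nat.card {u : Perm (Fin (2 * 3)) // (u * u = 1 ∧ ¬ PermContainsPattern u ![3, 4, 1, 2] ∧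
        ¬ PermContainsPattern u ![1, 2, 3]) ∧ ∀ i, u (Fin.rev i) = Fin.rev (u i)}] = [1, 1, 2, 1, 3, 1, 4] := by
  rw [card_centrosymmetric_av3412_av123_two_mul, card_centrosymmetric_av3412_av123_two_mul,
    card_centrosymmetric_av3412_av123_two_mul, card_centrosymmetric_av3412_av123_two_mul,
    card_centrosymmetric_av3412_av123_odd, card_centrosymmetric_av3412_av123_odd, card_centrosymmetric_av3412_av123_odd]

end PermContainsPattern

end Literature.Combinatorics.Enumerative
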